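import Literature.AlgebraicGeometry.Resolution.AffineBlowup
import HarnessLib

/-!
# The charts at a sub-family of generators cover the blowing up (radical form)

Support file for crux stmt-ResolutionOfSingularities-15315
(`FrobeniusLadder.FInjectiveMacaulayfication`, line `Sketch`, cycle 9, wave 1):
stub `stub_reesCoverOfPowers` of the §15 WEIGHTED CONE ENGINE.

The blowing up `Bl_I(Spec R) = Proj R[It]` is covered by the charts `D₊(b t)`, `b ∈ I`
(`irrelevant_le_span_reesT` of `AffineBlowup.lean` + `Proj.iSup_basicOpen_eq_top`). For a weighted
blow-up (`I` the ideal of monomials of weighted degree `≥ N`) only the "vertex" charts `D₊(X_j^{c_j} t)` are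
certifiable, and they still cover because every monomial generator `m` has a power `m^K = X_j^{c_j} · m'`
with `m' ∈ I^{K-1}` (Veronese splitting). This file proves the abstract form:

* `stub_reesCoverOfPowers` — if `I = (G)` and every `x ∈ G` has a power `x ^ K = v j * y` with
  `y ∈ I ^ (K - 1)`, `K ≥ 1`, for one of finitely many `v j ∈ I`, then the irrelevant ideal `R[It]₊` lies in
  the radical of the ideal `(v₁ t, …, v_t t)` of `R[It]` (so `Proj R[It] = ⋃ⱼ D₊(vⱼ t)`).

Proof layout (glue on `AffineBlowup.lean`'s `reesT`, `coe_reesT`, `irrelevant_le_span_reesT` and Mathlib's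
`reesAlgebra.monomial_mem`, `Submodule.span_induction`, `Ideal.radical`):
* `reesT_zero'`, `reesT_add'`, `reesT_smul'` — `b ↦ b t` is `R`-linear
  (`0 t = 0`, `(a + b) t = a t + b t`, `(r • a) t = r · (a t)`);
* `reesT_pow_succ_eq` — `(a t) ^ (k + 1) = (b t) · (y tᵏ)` when `a ^ (k + 1) = b y`, `y ∈ Iᵏ`;
* `reesT_mem_radical_span` — hence `b t ∈ √(v₁ t, …, v_t t)` for every `b ∈ I = (G)`: the radical is
  an ideal, so by span induction it suffices to treat `x ∈ G`, where `(x t) ^ K = (v j t) · (y t^{K-1})`;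
* `stub_reesCoverOfPowers` — combine with `R[It]₊ ⊆ (b t : b ∈ I)` (`irrelevant_le_span_reesT`).

## References

* The Stacks Project, Tag 0804 (the charts `D₊(a t) = Spec R[I/a]`, `a ∈ I`, cover the blowing up);
  the reduction to a sub-family whose powers divide is folklore (e.g. toric/weighted blow-ups).
-/

-- single-problem summit: the doubled namespace component is forced
set_option linter.dupNamespace false

namespace Summit.ResolutionOfSingularities.ResolutionOfSingularities.Theorems.FInjectiveMacaulayfication.ReesCoverOfPowers

open Literature.AlgebraicGeometry.Resolution Polynomial

variable {R : Type*} [CommRing R] {I : Ideal R}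

/-- `0 · t = 0` in `R[It]`. [folklore] -/
theorem reesT_zero' (h : (0 : R) ∈ I) : reesT (I := I) 0 h = 0 := by
  apply Subtype.ext
  change monomial 1 (0 : R) = 0
  rw [map_zero]

/-- `(a + b) t = a t + b t` in `R[It]`. [folklore] -/
theorem reesT_add' (a b : R) (ha : a ∈ I) (hb : b ∈ I) (h : a + b ∈ I) :
    reesT (a + b) h = reesT a ha + reesT b hb := by
  apply Subtype.ext
  change monomial 1 (a + b) = monomial 1 a + monomial 1 b
  rw [map_add]

/-- `(r • a) t = r · (a t)` in `R[It]` (with `r` viewed in degree zero). [folklore] -/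
theorem reesT_smul' (r a : R) (ha : a ∈ I) (h : r • a ∈ I) :
    reesT (r • a) h = algebraMap R (reesAlgebra I) r * reesT a ha := by
  apply Subtype.ext
  rw [Subalgebra.coe_mul, Subalgebra.coe_algebraMap, Polynomial.algebraMap_eq, coe_reesT, coe_reesT,
    C_mul_monomial, smul_eq_mul]

/-- `(a t) ^ (k + 1) = (b t) · (y tᵏ)` in `R[It]` whenever `a ^ (k + 1) = b y` with `y ∈ Iᵏ`. [folklore] -/
theorem reesT_pow_succ_eq (a : R) (ha : a ∈ I) (k : ℕ) (y : R) (hy : y ∈ I ^ k) (b : R) (hb : b ∈ I)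
    (h : a ^ (k + 1) = b * y) :
    reesT a ha ^ (k + 1) = reesT b hb * ⟨monomial k y, reesAlgebra.monomial_mem.mpr hy⟩ := by
  apply Subtype.ext
  change monomial 1 a ^ (k + 1) = monomial 1 b * monomial k y
  rw [monomial_pow, monomial_mul_monomial, one_mul, h, Nat.add_comm 1 k]

/-- For `I = (G)`: if every `x ∈ G` has a power `x ^ K = v j * y`, `K ≥ 1`, `y ∈ I ^ (K - 1)`, for one of
the `v j ∈ I`, then `b t ∈ √(v₁ t, …, v_t t)` for every `b ∈ I` (span induction on `b`; for a generator
`(x t) ^ K = (v j t) · (y t^{K-1})`). [folklore] -/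
theorem reesT_mem_radical_span {G : Set R} {t : ℕ} (v : Fin t → R) (hv : ∀ j : Fin t, v j ∈ Ideal.span G)
    (hpow : ∀ x ∈ G, ∃ (j : Fin t) (K : ℕ), 1 ≤ K ∧ ∃ y ∈ Ideal.span G ^ (K - 1), x ^ K = v j * y)
    (b : R) (hb : b ∈ Ideal.span G) :
    reesT (I := Ideal.span G) b hb ∈
      (Ideal.span (Set.range fun j : Fin t => reesT (I := Ideal.span G) (v j) (hv j))).radical := by
  induction hb using Submodule.span_induction with
  | mem x hxG =>
    obtain ⟨j, K, hK, y, hy, hxK⟩ := hpow x hxG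
    obtain ⟨k, rfl⟩ : ∃ k, K = k + 1 := ⟨K - 1, by omega⟩
    rw [Nat.add_sub_cancel] at hy
    refine ⟨k + 1, ?_⟩
    rw [reesT_pow_succ_eq x _ k y hy (v j) (hv j) hxK]
    exact Ideal.mul_mem_right _ _ (Ideal.subset_span ⟨j, rfl⟩)
  | zero =>
    rw [reesT_zero']
    exact Ideal.zero_mem _
  | add x y hx hy ihx ihy =>
    rw [reesT_add' x y hx hy]
    exact Ideal.add_mem _ ihx ihy
  | smul r x hx ihx =>
    rw [reesT_smul' r x hx]
    exact Ideal.mul_mem_left _ _ ihx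

/-- **THE CHARTS AT A SUB-FAMILY COVER** (radical form; stub `stub_reesCoverOfPowers` of line `Sketch`): if
`I = (G)` and every generator `x ∈ G` has a power `x ^ K = vⱼ · y` with `y ∈ I ^ (K - 1)` for one of finitely
many `vⱼ ∈ I`, then the irrelevant ideal of the Rees algebra `R[It]` lies in the radical of `(v₁ t, …, v_t t)`:
every point of `Proj R[It]` lies in some `D₊(vⱼ t)` (`R[It]₊ ⊆ (b t : b ∈ I)` by `irrelevant_le_span_reesT`,
and each `b t` lies in the radical by `reesT_mem_radical_span`). [folklore] -/
theorem stub_reesCoverOfPowers : ∀ (R : Type) [CommRing R] (I : Ideal R) (G : Set R), I = Ideal.span G →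
    ∀ (t : ℕ) (v : Fin t → R) (hv : ∀ j : Fin t, v j ∈ I),
    (∀ x ∈ G, ∃ (j : Fin t) (K : ℕ), 1 ≤ K ∧ ∃ y ∈ I ^ (K - 1), x ^ K = v j * y) →
    (HomogeneousIdeal.irrelevant (reesGrading I)).toIdeal ≤
      (Ideal.span (Set.range fun j : Fin t => reesT (I := I) (v j) (hv j))).radical := by
  intro R _ I G hIG t v hv hpow
  subst hIG
  refine le_trans (irrelevant_le_span_reesT (Ideal.span G)) ?_
  rw [Ideal.span_le]
  rintro _ ⟨b, rfl⟩
  exact reesT_mem_radical_span v hv hpow b.1 b.2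

end Summit.ResolutionOfSingularities.ResolutionOfSingularities.Theorems.FInjectiveMacaulayfication.ReesCoverOfPowers
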